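import Literature.Probability.Percolation.SlabGluingFact2Reduction
import HarnessLib

/-!
# DST 2016, §2.3, Fact 2 — the local surgery with an abstract cleared set and routing oracle

Topic: `Literature/Probability/Percolation`. Towards the verbatim discharge of
`DuminilCopinSidoraviciusTassion2016_fact2` (`SlabGluing.lean`; see `SlabGluingFact2Reduction.lean`
for the reduction to located surgeries `GlueGeom.SurgOut`). The tree's `GlueGeom.exists_surgery`
(`SlabGluingRouting.lean`) constructs the surgery data `GlueGeom.Surgery` at a point `z ∈ U(ω)` for
ONE cleared box (`GlueGeom.Dbox z`), and therefore needs `z ∉ zBad ∪ lastBad` and `u_{3n} + 1 ≤ n`.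
The verbatim statement needs surgeries at the excluded points as well, with differently shaped
cleared sets (a box without the boundary column `x = 3n`, a box without the column `x = n`, …).
This file separates the GENERIC part of that construction from the choice of the box:

* `GlueGeom.exists_surgery_of_oracle` — PROVED: for `ω ∈ 𝒳` a lattice configuration, ANY set of
  cleared columns `D ⊆ B_{3n} ∪ B'_n` containing a column `z` of `γ_min(ω)` and the column of a
  witness `x₀` of (P2) (an `ω`-open path from `x₀` to `S̄'_n` inside `B̄'_n` off the columns of
  `γ_min`), avoiding the first and the last vertex of `γ_min(ω)`, with at most one lattice
  neighbour of `z` inside `B_{3n}` outside `D`, and ANY routing oracle (producing a `RouteSpec` in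
  a region `RP ⊆ D ∩ B_{3n} ∖ Z_n` containing `D ∩ B_{3n} ∖ Z_n`, together with the key condition
  of `GlueGeom.Surgery` for its structure vertices over `S_{3n}`) yield surgery data with cleared
  set exactly `D` (proof: that of `GlueGeom.exists_surgery`, the decomposition of `γ_min(ω)` at its
  first and last visits to `D̄`, the last vertex of the witness path in `D̄`, the oracle);
* `GlueGeom.exists_surgery_rect` — PROVED: the rectangle case (`D`, `RP` rectangles as in
  `exists_route`, `D ∩ S_{3n} = ∅`), the oracle being the tree's `exists_route`;
* the two concrete boxes `GlueGeom.boxA z` (the box of `exists_surgery` with left column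
  `max (z₁ - 3, n, u_{3n} + 1)`, so that it never meets `S_{3n}`) and `GlueGeom.boxB z` (the same
  with the boundary column `x = 3n` removed, so that it never meets `Z_n` nor the end of
  `γ_min(ω)`), their elementary geometry, and PROVED: located surgery outputs
  `GlueGeom.exists_surgOut_boxA` (at `z ∉ zBad` with the end of `γ_min` off the box — all `z` with
  `z₁ ≥ u_{3n} + 1`, in particular the whole range `u_{3n} ≤ n` for `z₁ ≥ n + 1`) and
  `GlueGeom.exists_surgOut_boxB` (at EVERY `z` with `z₁ ≤ 3n - 1`, `z₁ ≥ max(n, u_{3n}+1)` whose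
  witness column is `≤ 3n - 1` — no condition near `Z_n` or the end of `γ_min`).

What this buys for `…_fact2` (see the unit notes): hypothesis (H1) of
`DuminilCopinSidoraviciusTassion2016_fact2_of_surgOut` outside the strip `z₁ ≤ n` when
`u_{3n} = n` and outside witnesses in the column `x = n`; and most cases of (H2). The remaining
cases (witness or point on the boundary columns `x = 3n` / `x = n`) need other oracles.

## Sources

* H. Duminil-Copin, V. Sidoravicius, V. Tassion, *Absence of infinite cluster for critical
  Bernoulli percolation on slabs*, CPAM 69 (2016), 1397–1411, arXiv:1401.7130: §2.3, proof of
  Fact 2 (pp. 6–7: the ball `B_R(z)`, `u'`, `v'`, `w'`, the three disjoint paths).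
* C. M. Newman, V. Tassion, W. Wu, *Critical percolation and the minimal spanning tree in slabs*,
  CPAM 70 (2017), §3.2, Definition 3.7 and proof of Thm. 3.9 [NewmanTassionWu2017].
-/

noncomputable section

namespace Literature.Probability.Percolation

open LatticeModels SimpleGraph

variable {k : ℕ}

/-! ## The surgery from an abstract cleared set and a routing oracle -/

section Oracle

namespace GlueGeom

variable {G : GlueGeom}

/-- PROVED — **the local surgery from a routing oracle.** For `ω ∈ 𝒳` a lattice configuration, a
set `D ⊆ B_{3n} ∪ B'_n` of cleared columns, a routing region `RP` with
`D ∩ B_{3n} ∖ Z_n ⊆ RP ⊆ D ∩ B_{3n} ∖ Z_n`, a column `z ∈ D` of `γ_min(ω)` with at most one lattice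
neighbour inside `B_{3n}` outside `D`, the first and last vertices of `γ_min(ω)` off `D̄`, a witness
`x₀` over `D` joined to `S̄'_n` inside `B̄'_n` off the columns of `γ_min(ω)`, and an oracle routing
any admissible `(E₁, E₂, w')` in `(RP, D)` with the key condition over `S_{3n}`: surgery data with
cleared set `D` exist (DST 2016, proof of Fact 2, construction of `ω^{(z)}`; the proof of
`GlueGeom.exists_surgery` with the box abstracted). [cite: DuminilCopinSidoraviciusTassion2016, §2.3, proof of Fact 2 (construction of ω^{(z)})] -/
theorem exists_surgery_of_oracle {ω : BondConfig (slab 3 k)} (hω : ω ⊆ (slabGraph 3 k).edgeSet)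
    (hX : ω ∈ G.evX k) {D RP : Set (ℤ × ℤ)} (hDreg : D ⊆ G.big ∪ G.small) (hRPD : RP ⊆ D)
    (hRPbig : RP ⊆ G.big) (hRPZ : ∀ q ∈ RP, q ∉ G.zSeg)
    (hRP : ∀ q ∈ D, q ∈ G.big → q ∉ G.zSeg → q ∈ RP)
    {z : ℤ × ℤ} (hzD : z ∈ D) (hzγ : z ∈ G.γcols k ω)
    (hnbr : ∃ q₀ : ℤ × ℤ, ∀ q, planarAdj z q → q ∈ G.big → q ∉ D → q = q₀)
    (hfirst : ∀ v ∈ (G.γmin k ω).head?, planar k v ∉ D)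
    (hlast : ∀ v ∈ (G.γmin k ω).getLast?, planar k v ∉ D)
    {x₀ s' : slab 3 k} (hx₀D : planar k x₀ ∈ D) (hs' : s' ∈ slabLift k G.src')
    (hπ : ω ∈ openConnIn (slabLift k G.small ∩ {v | planar k v ∉ G.γcols k ω}) x₀ s')
    (oracle : ∀ E₁ E₂ w' : slab 3 k, planar k E₁ ∈ RP → planar k E₂ ∈ RP → planar k w' ∈ D →
      E₁ ≠ E₂ → planar k E₁ ≠ planar k w' → planar k E₂ ≠ planar k w' →
      E₁ ∈ G.γmin k ω → E₂ ∈ G.γmin k ω →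
      ∃ (L Br : List (slab 3 k)) (c : slab 3 k), RouteSpec k RP D E₁ E₂ w' L Br c ∧
        ∀ v ∈ L.tail.dropLast ++ Br.dropLast, v ∈ slabLift k G.src → v ∉ G.γmin k ω →
          ∀ b ∈ (G.γmin k ω).head?, vKey k b ≤ vKey k v) :
    ∃ sg : G.Surgery k ω, sg.D = D := by
  classical
  have hA : ω ∈ G.evA k := hX.1.1.1
  obtain ⟨hγO, -⟩ := G.γmin_spec k hA
  set γ := G.γmin k ω with hγdef
  obtain ⟨g, hgγ, hgz⟩ := hzγ
  rw [← hγdef] at hgγ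
  have hγmp : minPath k ω (slabLift k G.big) (slabLift k G.src) (slabLift k G.zSeg) = γ := rfl
  have hzbig : z ∈ G.big := by rw [← hgz]; exact hγO.subset g hgγ
  have hS := G.big_finite k
  have hex : ∃ l, IsOSAP k ω (slabLift k G.big) (slabLift k G.src) (slabLift k G.zSeg) l :=
    (mem_slabConn_iff_exists_isOSAP ω _ _ _).1 hA
  have hlastD : ∀ v, γ.getLast? = some v → planar k v ∉ D := fun v hv => hlast v (Option.mem_def.2 hv)
  -- first visit of `γ` to `D̄`
  obtain ⟨p₀, E₁, rest₁, hγ1, hE₁D, hp₀D⟩ :=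
    exists_first_split (p := fun x => planar k x ∈ D) γ ⟨g, hgγ, by rw [hgz]; exact hzD⟩
  have hp₀ : p₀ ≠ [] := by
    rintro rfl
    exact hfirst E₁ (by rw [hγ1]; rfl) hE₁D
  have hrest₁ : rest₁ ≠ [] := by
    rintro rfl
    exact hlastD E₁ (by rw [hγ1]; simp) hE₁D
  -- `γ` visits `D̄` again after `E₁`
  have hmeet : ∃ x ∈ rest₁, planar k x ∈ D := by
    by_contra hno
    push Not at hno
    obtain ⟨q₀, hq₀⟩ := hnbr
    have hgE₁ : g = E₁ := by
      rw [hγ1] at hgγ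
      rcases List.mem_append.1 hgγ with h | h
      · exact absurd (hgz ▸ hzD) (hp₀D g h)
      · rcases List.mem_cons.1 h with h | h
        · exact h
        · exact absurd (hgz ▸ hzD) (hno g h)
    have hch := hγO.chain
    rw [hγ1, List.isChain_append] at hch
    obtain ⟨-, hch2, hlink⟩ := hch
    set u := p₀.getLast hp₀ with hu'
    set w := rest₁.head hrest₁ with hw
    have huE : s(u, E₁) ∈ ω := (hlink u (by rw [List.getLast?_eq_some_getLast hp₀]; rfl) E₁ (by simp)).1
    have hEw : s(E₁, w) ∈ ω := by
      rw [List.isChain_cons] at hch2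
      exact (hch2.1 w (by rw [List.head?_eq_some_head hrest₁]; rfl)).1
    have hup₀ : u ∈ p₀ := List.getLast_mem hp₀
    have hwr : w ∈ rest₁ := List.head_mem hrest₁
    have huγ : u ∈ γ := by rw [hγ1]; exact List.mem_append_left _ hup₀
    have hwγ : w ∈ γ := by rw [hγ1]; simp [hwr]
    have hadj₁ := (slab_adj_iff _ _).1 ((SimpleGraph.mem_edgeSet _).1 (hω huE))
    have hadj₂ := (slab_adj_iff _ _).1 ((SimpleGraph.mem_edgeSet _).1 (hω hEw))
    have hpE₁ : planar k E₁ = z := by rw [← hgE₁]; exact hgz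
    rw [hpE₁] at hadj₁ hadj₂
    have hu1 : planar k u = q₀ := by
      rcases hadj₁ with ⟨-, hpa⟩ | ⟨hpe, -⟩
      · exact hq₀ _ (planarAdj_symm hpa) (hγO.subset u huγ) (hp₀D u hup₀)
      · exact absurd (hpe ▸ hzD) (hp₀D u hup₀)
    have hw1 : planar k w = q₀ := by
      rcases hadj₂ with ⟨-, hpa⟩ | ⟨hpe, -⟩
      · exact hq₀ _ hpa (hγO.subset w hwγ) (hno w hwr)
      · exact absurd (hpe ▸ hzD) (hno w hwr)
    have hht : ht u = ht w := by
      rcases hadj₁ with ⟨h1, -⟩ | ⟨hpe, -⟩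
      · rcases hadj₂ with ⟨h2, -⟩ | ⟨hpe, -⟩
        · omega
        · exact absurd (hpe ▸ hzD) (hno w hwr)
      · exact absurd (hpe ▸ hzD) (hp₀D u hup₀)
    have huw : u = w := (slab_ext_iff u w).2 ⟨hu1.trans hw1.symm, hht⟩
    have hnd := hγO.nodup
    rw [hγ1, List.nodup_append] at hnd
    exact hnd.2.2 u hup₀ w (List.mem_cons_of_mem _ hwr) huw
  -- last visit of `γ` to `D̄`
  obtain ⟨mid, E₂, s₀, hrest, hE₂D, hs₀D⟩ := exists_last_split (p := fun x => planar k x ∈ D) rest₁ hmeet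
  have hγeq : γ = p₀ ++ E₁ :: (mid ++ E₂ :: s₀) := by rw [hγ1, hrest]
  have hs₀ : s₀ ≠ [] := by
    rintro rfl
    have : γ = (p₀ ++ E₁ :: mid) ++ [E₂] := by rw [hγeq]; simp
    exact hlastD E₂ (by rw [this, List.getLast?_concat]) hE₂D
  have hE₁₂ : E₁ ≠ E₂ := by
    intro h
    have hnd := hγO.nodup
    rw [hγeq, List.nodup_append] at hnd
    have := (List.nodup_cons.1 hnd.2.1).1
    exact this (by rw [h]; simp)
  -- `E₁`, `E₂` are off `Z_n`
  have hE₁Z : planar k E₁ ∉ G.zSeg := by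
    have h := minPath_prefix_getLast_not_mem hS hex (p := p₀ ++ [E₁]) (s := mid ++ E₂ :: s₀)
      (by rw [hγmp, hγeq]; simp) (by simp) (by simp)
    simpa using h
  have hE₂Z : planar k E₂ ∉ G.zSeg := by
    have h := minPath_prefix_getLast_not_mem hS hex (p := p₀ ++ E₁ :: mid ++ [E₂]) (s := s₀)
      (by rw [hγmp, hγeq]; simp) hs₀ (by simp)
    simpa using h
  have hE₁γ : E₁ ∈ γ := by rw [hγeq]; simp
  have hE₂γ : E₂ ∈ γ := by rw [hγeq]; simp
  have hE₁RP : planar k E₁ ∈ RP := hRP _ hE₁D (hγO.subset E₁ hE₁γ) hE₁Z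
  have hE₂RP : planar k E₂ ∈ RP := hRP _ hE₂D (hγO.subset E₂ hE₂γ) hE₂Z
  -- the witness path `π` of (P2) and its last vertex `w'` in `D̄`
  obtain ⟨π, hπO⟩ := exists_isOSAP_of_openConnIn hπ
  have hx₀π : x₀ ∈ π := by
    have := hπO.head_mem hπO.ne_nil
    rw [Set.mem_singleton_iff] at this
    rw [← this]; exact List.head_mem _
  obtain ⟨πpre, w', sgt, hπeq, hw'D, hsgtD⟩ :=
    exists_last_split (p := fun x => planar k x ∈ D) π ⟨x₀, hx₀π, hx₀D⟩
  have hw'π : w' ∈ π := by rw [hπeq]; simp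
  have hw'γ : planar k w' ∉ G.γcols k ω := (hπO.subset w' hw'π).2
  have hw'E₁ : planar k E₁ ≠ planar k w' := fun h => hw'γ ⟨E₁, hE₁γ, h⟩
  have hw'E₂ : planar k E₂ ≠ planar k w' := fun h => hw'γ ⟨E₂, hE₂γ, h⟩
  -- routing
  obtain ⟨L, Br, c, spec, hkey⟩ := oracle E₁ E₂ w' hE₁RP hE₂RP hw'D hE₁₂ hw'E₁ hw'E₂ hE₁γ hE₂γ
  set P := L.tail.dropLast with hP
  have hLeq : L = E₁ :: (P ++ [E₂]) := spec.hL.eq_cons_dropLast_concat hE₁₂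
  have hPL : ∀ v ∈ P, v ∈ L := fun v hv => by
    rw [hLeq]; exact List.mem_cons_of_mem _ (List.mem_append_left _ hv)
  have hBrlast : Br.getLast spec.hBr = w' := by
    have h1 := spec.hCB.last
    rw [List.getLast?_cons, List.getLast?_eq_some_getLast spec.hBr] at h1
    simpa using h1
  -- the `S'`-side path `σ = w' :: sgt`
  have hπch := hπO.chain
  rw [hπeq, List.isChain_append] at hπch
  refine ⟨⟨D, p₀, E₁, mid, E₂, s₀, P, c, Br, w' :: sgt,
    hDreg, hγeq, hp₀, hs₀, hp₀D, hs₀D, hE₁D, hE₂D,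
    fun x hx => hRPD (spec.hL_sub x (hPL x hx)),
    fun x hx => hRPbig (spec.hL_sub x (hPL x hx)),
    fun x hx => hRPZ _ (spec.hL_sub x (hPL x hx)),
    hLeq ▸ spec.hL.chain, hLeq ▸ spec.hL.nodup,
    ?_, spec.hBr, spec.hBr_sub,
    spec.hCB.chain.imp fun a b h => h, spec.hCB.nodup,
    fun x hx => hLeq ▸ spec.hBr_L x hx,
    fun l₁ l₂ y h => spec.hfwd l₁ l₂ y (hLeq.trans h) _ (List.head?_eq_some_head spec.hBr ▸ rfl),
    fun v hv => hkey v hv, (by rw [hBrlast]; rfl), hπch.2.1,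
    fun x hx => (hπO.subset x (by rw [hπeq]; exact List.mem_append_right _ hx)).1,
    fun x hx => (hπO.subset x (by rw [hπeq]; exact List.mem_append_right _ hx)).2,
    hsgtD,
    fun h => ?_⟩, rfl⟩
  · -- `c ∈ E₁ :: P`
    have hc := spec.hc
    rw [hLeq] at hc
    simp only [List.mem_cons, List.mem_append, List.not_mem_nil, or_false] at hc ⊢
    rcases hc with h | h | h
    · exact Or.inl h
    · exact Or.inr h
    · exact absurd h spec.hcE₂
  · -- `σ` ends in `S̄'_n`
    have := hπO.last_mem hπO.ne_nil
    rw [Set.mem_singleton_iff] at this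
    have h2 : (w' :: sgt).getLast h = π.getLast hπO.ne_nil := by
      rw [List.getLast_congr _ (by simp) hπeq, List.getLast_append_of_ne_nil _ (List.cons_ne_nil _ _)]
    rw [h2, this]; exact hs'

/-- PROVED — **the rectangle case**: cleared set `D = [xL, xR] × [rB, rT]` inside
`B_{3n} ∪ B'_n` and disjoint from `S_{3n}`, routing rectangle `RP = [xL, xR'] × [rB, rP]` at least
`3 × 4`, inside `B_{3n}`, off `Z_n` and containing `D ∩ B_{3n} ∖ Z_n`; then the tree's routing
`exists_route` is an oracle (the key condition over `S_{3n}` being vacuous), so surgery data with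
cleared set `D` exist at any column `z ∈ D` of `γ_min(ω)` with at most one lattice neighbour inside
`B_{3n}` outside `D`, provided the end of `γ_min(ω)` is off `D̄` and a (P2)-witness lies over `D`.
[cite: DuminilCopinSidoraviciusTassion2016, §2.3, proof of Fact 2 (construction of ω^{(z)})] -/
theorem exists_surgery_rect (hk : 0 < k) {ω : BondConfig (slab 3 k)}
    (hω : ω ⊆ (slabGraph 3 k).edgeSet) (hX : ω ∈ G.evX k) {xL xR' xR rB rP rT : ℤ}
    (hcols : xL + 2 ≤ xR') (hxR : xR' ≤ xR) (hrows : rB + 3 ≤ rP) (hrP : rP ≤ rT)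
    (hDreg : boxR xL xR rB rT ⊆ G.big ∪ G.small) (hDsrc : ∀ q ∈ boxR xL xR rB rT, q ∉ G.src)
    (hRPbig : boxR xL xR' rB rP ⊆ G.big) (hRPZ : ∀ q ∈ boxR xL xR' rB rP, q ∉ G.zSeg)
    (hRP : ∀ q ∈ boxR xL xR rB rT, q ∈ G.big → q ∉ G.zSeg → q ∈ boxR xL xR' rB rP)
    {z : ℤ × ℤ} (hzD : z ∈ boxR xL xR rB rT) (hzγ : z ∈ G.γcols k ω)
    (hnbr : ∃ q₀ : ℤ × ℤ, ∀ q, planarAdj z q → q ∈ G.big → q ∉ boxR xL xR rB rT → q = q₀)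
    (hlast : ∀ v ∈ (G.γmin k ω).getLast?, planar k v ∉ boxR xL xR rB rT)
    {x₀ s' : slab 3 k} (hx₀D : planar k x₀ ∈ boxR xL xR rB rT) (hs' : s' ∈ slabLift k G.src')
    (hπ : ω ∈ openConnIn (slabLift k G.small ∩ {v | planar k v ∉ G.γcols k ω}) x₀ s') :
    ∃ sg : G.Surgery k ω, sg.D = boxR xL xR rB rT := by
  have hA : ω ∈ G.evA k := hX.1.1.1
  obtain ⟨hγO, -⟩ := G.γmin_spec k hA
  have hRPD : boxR xL xR' rB rP ⊆ boxR xL xR rB rT := fun q hq => by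
    rw [mem_boxR_iff] at hq ⊢; omega
  refine exists_surgery_of_oracle hω hX hDreg hRPD hRPbig hRPZ hRP hzD hzγ hnbr ?_ hlast hx₀D hs' hπ ?_
  · -- the first vertex of `γ_min` lies over `S_{3n}`, hence off `D`
    intro v hv hvD
    have hne := hγO.ne_nil
    have hv' : v = (G.γmin k ω).head hne := by
      rw [List.head?_eq_some_head hne] at hv
      simpa using hv.symm
    have hsrc := hγO.head_mem hne
    rw [← hv', mem_slabLift_iff] at hsrc
    exact hDsrc _ hvD hsrc
  · intro E₁ E₂ w' h1 h2 h3 h4 h5 h6 _ _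
    obtain ⟨L, Br, c, spec⟩ := exists_route hk hcols hxR hrows hrP h1 h2 h3 h4 h5 h6
    refine ⟨L, Br, c, spec, fun v hv hvsrc _ => ?_⟩
    exfalso
    rw [mem_slabLift_iff] at hvsrc
    rcases List.mem_append.1 hv with h | h
    · have hvL : v ∈ L := List.mem_of_mem_tail (List.dropLast_subset _ h)
      exact hDsrc _ (hRPD (spec.hL_sub v hvL)) hvsrc
    · exact hDsrc _ (spec.hBr_sub v (List.dropLast_subset _ h)) hvsrc

end GlueGeom

end Oracle

/-! ## Two concrete boxes -/

section Boxes

namespace GlueGeom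

variable (G : GlueGeom)

/-- Left column of the boxes: `max (z₁ - 3, n, u_{3n} + 1)` (the boxes never meet `S_{3n}`).
[cite: DuminilCopinSidoraviciusTassion2016, §2.3, proof of Fact 2 (the ball B_R(z))] -/
def bxL' (z : ℤ × ℤ) : ℤ := max (z.1 - 3) (max G.n (G.u₃ + 1))

/-- Right column of the box `boxB`: `min (z₁ + 3, 3n - 1)` (the boundary column `x = 3n` removed).
[cite: DuminilCopinSidoraviciusTassion2016, §2.3, proof of Fact 2 (the ball B_R(z))] -/
def bxRB (z : ℤ × ℤ) : ℤ := min (z.1 + 3) (3 * G.n - 1)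

/-- **Box A**: the box of `GlueGeom.Dbox` with left column `bxL'`. [cite: DuminilCopinSidoraviciusTassion2016, §2.3, proof of Fact 2 (the ball B_R(z))] -/
def boxA (z : ℤ × ℤ) : Set (ℤ × ℤ) := boxR (G.bxL' z) (G.bxR z) (G.brB z) (G.brT z)

/-- The routing rectangle of box A (right column dropped when covered by `Z_n`). [folklore] -/
def rpA (z : ℤ × ℤ) : Set (ℤ × ℤ) := boxR (G.bxL' z) (G.bxR' z) (G.brB z) (G.brP z)

/-- **Box B**: box A without the boundary column `x = 3n`. [cite: DuminilCopinSidoraviciusTassion2016, §2.3, proof of Fact 2 (the ball B_R(z))] -/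
def boxB (z : ℤ × ℤ) : Set (ℤ × ℤ) := boxR (G.bxL' z) (G.bxRB z) (G.brB z) (G.brT z)

/-- The routing rectangle of box B: its part inside `B_{3n}`. [folklore] -/
def rpB (z : ℤ × ℤ) : Set (ℤ × ℤ) := boxR (G.bxL' z) (G.bxRB z) (G.brB z) (G.brP z)

variable {G}

section BoxFacts

variable {z : ℤ × ℤ}

/-- Box A is the old box when `u_{3n} + 1 ≤ n`. [folklore] -/
theorem bxL'_eq_bxL (hu : G.u₃ + 1 ≤ G.n) : G.bxL' z = G.bxL z := by
  simp only [bxL', bxL]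
  omega

/-- Box A lies in `z + B_3`. [folklore] -/
theorem boxA_subset_sqBox : G.boxA z ⊆ sqBox z 3 := by
  intro q hq
  simp only [boxA, mem_boxR_iff, bxL', bxR, brB, brT] at hq
  simp only [sqBox, Set.mem_setOf_eq, abs_le, Nat.cast_ofNat]
  omega

/-- Box B lies in `z + B_3`. [folklore] -/
theorem boxB_subset_sqBox : G.boxB z ⊆ sqBox z 3 := by
  intro q hq
  simp only [boxB, mem_boxR_iff, bxL', bxRB, brB, brT] at hq
  simp only [sqBox, Set.mem_setOf_eq, abs_le, Nat.cast_ofNat]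
  omega

/-- The boxes avoid `S_{3n}`. [folklore] -/
theorem not_src_of_bxL'_le {q : ℤ × ℤ} (hq : G.bxL' z ≤ q.1) : q ∉ G.src := by
  simp only [bxL'] at hq
  simp only [src, sqBox, Set.mem_setOf_eq, abs_le, Prod.fst_zero, Prod.snd_zero, sub_zero, not_and]
  intro h; omega

/-- Box A avoids `S_{3n}`. [folklore] -/
theorem boxA_not_src {q : ℤ × ℤ} (hq : q ∈ G.boxA z) : q ∉ G.src :=
  not_src_of_bxL'_le (z := z) (by simp only [boxA, mem_boxR_iff] at hq; exact hq.1)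

/-- Box B avoids `S_{3n}`. [folklore] -/
theorem boxB_not_src {q : ℤ × ℤ} (hq : q ∈ G.boxB z) : q ∉ G.src :=
  not_src_of_bxL'_le (z := z) (by simp only [boxB, mem_boxR_iff] at hq; exact hq.1)

/-- Frame of box A: three columns for the routing rectangle, four rows inside `B_{3n}`.
[folklore] -/
theorem boxA_frame (hG : G.InRange) (hzb : z ∈ G.big) (hzs : z ∈ G.small) (hz : G.bxL' z ≤ z.1) :
    G.bxL' z + 2 ≤ G.bxR' z ∧ G.bxR' z ≤ G.bxR z ∧ G.brB z + 3 ≤ G.brP z ∧ G.brP z ≤ G.brT z := by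
  obtain ⟨hn, hu₃, hu₁, hα, hαn, hy0, hy⟩ := hG
  simp only [big, small, sqBox, Set.mem_setOf_eq, abs_le, Prod.fst_zero, Prod.snd_zero, sub_zero] at hzb hzs
  simp only [bxL'] at hz
  simp only [bxL', bxR, bxR', brB, brP, brT, Zfull]
  split_ifs <;> omega

/-- Frame of box B (for `z₁ ≤ 3n - 1`). [folklore] -/
theorem boxB_frame (hG : G.InRange) (hzb : z ∈ G.big) (hzs : z ∈ G.small) (hz : G.bxL' z ≤ z.1)
    (hz1 : z.1 ≤ 3 * G.n - 1) :
    G.bxL' z + 2 ≤ G.bxRB z ∧ G.bxRB z ≤ G.bxRB z ∧ G.brB z + 3 ≤ G.brP z ∧ G.brP z ≤ G.brT z := by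
  obtain ⟨hn, hu₃, hu₁, hα, hαn, hy0, hy⟩ := hG
  simp only [big, small, sqBox, Set.mem_setOf_eq, abs_le, Prod.fst_zero, Prod.snd_zero, sub_zero] at hzb hzs
  simp only [bxL'] at hz
  simp only [bxL', bxRB, brB, brP, brT]
  omega

/-- Box A lies in `B_{3n} ∪ B'_n`. [folklore] -/
theorem boxA_subset_region (hG : G.InRange) (hzb : z ∈ G.big) (hzs : z ∈ G.small) :
    G.boxA z ⊆ G.big ∪ G.small := by
  obtain ⟨hn, hu₃, hu₁, hα, hαn, hy0, hy⟩ := hG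
  simp only [big, small, sqBox, Set.mem_setOf_eq, abs_le, Prod.fst_zero, Prod.snd_zero, sub_zero] at hzb hzs
  intro q hq
  simp only [boxA, mem_boxR_iff, bxL', bxR, brB, brT] at hq
  simp only [big, small, sqBox, Set.mem_union, Set.mem_setOf_eq, abs_le, Prod.fst_zero, Prod.snd_zero, sub_zero]
  omega

/-- Box B lies in box A. [folklore] -/
theorem boxB_subset_boxA : G.boxB z ⊆ G.boxA z := by
  intro q hq
  simp only [boxB, boxA, mem_boxR_iff, bxRB, bxR] at hq ⊢
  omega

/-- Box B lies in `B_{3n} ∪ B'_n`. [folklore] -/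
theorem boxB_subset_region (hG : G.InRange) (hzb : z ∈ G.big) (hzs : z ∈ G.small) :
    G.boxB z ⊆ G.big ∪ G.small :=
  boxB_subset_boxA.trans (boxA_subset_region hG hzb hzs)

/-- The routing rectangle of box A lies in `B_{3n}`. [folklore] -/
theorem rpA_subset_big (hG : G.InRange) (hzb : z ∈ G.big) (hzs : z ∈ G.small) : G.rpA z ⊆ G.big := by
  obtain ⟨hn, hu₃, hu₁, hα, hαn, hy0, hy⟩ := hG
  simp only [big, small, sqBox, Set.mem_setOf_eq, abs_le, Prod.fst_zero, Prod.snd_zero, sub_zero] at hzb hzs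
  intro q hq
  simp only [rpA, mem_boxR_iff, bxL', bxR', bxR, brB, brP, brT, Zfull] at hq
  simp only [big, sqBox, Set.mem_setOf_eq, abs_le, Prod.fst_zero, Prod.snd_zero, sub_zero]
  split_ifs at hq <;> omega

/-- The routing rectangle of box B lies in `B_{3n}`. [folklore] -/
theorem rpB_subset_big (hG : G.InRange) (hzb : z ∈ G.big) (hzs : z ∈ G.small) : G.rpB z ⊆ G.big := by
  obtain ⟨hn, hu₃, hu₁, hα, hαn, hy0, hy⟩ := hG
  simp only [big, small, sqBox, Set.mem_setOf_eq, abs_le, Prod.fst_zero, Prod.snd_zero, sub_zero] at hzb hzs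
  intro q hq
  simp only [rpB, mem_boxR_iff, bxL', bxRB, brB, brP, brT] at hq
  simp only [big, sqBox, Set.mem_setOf_eq, abs_le, Prod.fst_zero, Prod.snd_zero, sub_zero]
  omega

/-- Off the excluded strip `zBad`, the routing rectangle of box A avoids `Z_n`. [folklore] -/
theorem rpA_not_zSeg (hG : G.InRange) (hzb : z ∈ G.big) (hbad : z ∉ G.zBad) {q : ℤ × ℤ}
    (hq : q ∈ G.rpA z) : q ∉ G.zSeg := by
  obtain ⟨hn, hu₃, hu₁, hα, hαn, hy0, hy⟩ := hG
  simp only [big, sqBox, Set.mem_setOf_eq, abs_le, Prod.fst_zero, Prod.snd_zero, sub_zero] at hzb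
  simp only [zBad, Set.mem_setOf_eq, not_and, not_or] at hbad
  simp only [rpA, mem_boxR_iff, bxL', bxR', bxR, brB, brP, brT, Zfull] at hq
  simp only [zSeg, sideSeg, Set.mem_setOf_eq, not_and]
  intro h1
  split_ifs at hq with hZ <;> omega

/-- The routing rectangle of box B avoids `Z_n` (it avoids the column `x = 3n`). [folklore] -/
theorem rpB_not_zSeg {q : ℤ × ℤ} (hq : q ∈ G.rpB z) : q ∉ G.zSeg := by
  simp only [rpB, mem_boxR_iff, bxRB] at hq
  simp only [zSeg, sideSeg, Set.mem_setOf_eq, not_and]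
  intro h1; omega

/-- A point of box A inside `B_{3n}` and off `Z_n` lies in its routing rectangle. [folklore] -/
theorem mem_rpA_of (hG : G.InRange) {q : ℤ × ℤ} (hq : q ∈ G.boxA z) (hqb : q ∈ G.big)
    (hqZ : q ∉ G.zSeg) : q ∈ G.rpA z := by
  obtain ⟨hn, hu₃, hu₁, hα, hαn, hy0, hy⟩ := hG
  simp only [big, sqBox, Set.mem_setOf_eq, abs_le, Prod.fst_zero, Prod.snd_zero, sub_zero] at hqb
  simp only [zSeg, sideSeg, Set.mem_setOf_eq, not_and] at hqZ
  simp only [boxA, mem_boxR_iff] at hq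
  simp only [rpA, mem_boxR_iff, bxR', brP, Zfull]
  split_ifs with hZ
  · simp only [bxR, brT, brB] at hZ hq ⊢
    refine ⟨hq.1, ?_, hq.2.2.1, by omega⟩
    rcases lt_or_eq_of_le hq.2.1 with h | h
    · omega
    · exfalso; exact hqZ (by omega) (by omega) (by omega)
  · exact ⟨hq.1, hq.2.1, hq.2.2.1, by omega⟩

/-- A point of box B inside `B_{3n}` lies in its routing rectangle. [folklore] -/
theorem mem_rpB_of (hG : G.InRange) {q : ℤ × ℤ} (hq : q ∈ G.boxB z) (hqb : q ∈ G.big) : q ∈ G.rpB z := by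
  obtain ⟨hn, hu₃, hu₁, hα, hαn, hy0, hy⟩ := hG
  simp only [big, sqBox, Set.mem_setOf_eq, abs_le, Prod.fst_zero, Prod.snd_zero, sub_zero] at hqb
  simp only [boxB, mem_boxR_iff] at hq
  simp only [rpB, mem_boxR_iff, brP]
  exact ⟨hq.1, hq.2.1, hq.2.2.1, by omega⟩

/-- `z` lies in box A when `bxL' z ≤ z₁`. [folklore] -/
theorem mem_boxA_self (hG : G.InRange) (hzb : z ∈ G.big) (hzs : z ∈ G.small) (hz : G.bxL' z ≤ z.1) :
    z ∈ G.boxA z := by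
  obtain ⟨hn, hu₃, hu₁, hα, hαn, hy0, hy⟩ := hG
  simp only [big, small, sqBox, Set.mem_setOf_eq, abs_le, Prod.fst_zero, Prod.snd_zero, sub_zero] at hzb hzs
  simp only [boxA, mem_boxR_iff, bxR, brB, brT]
  omega

/-- `z` lies in box B when `bxL' z ≤ z₁ ≤ 3n - 1`. [folklore] -/
theorem mem_boxB_self (hG : G.InRange) (hzs : z ∈ G.small) (hz : G.bxL' z ≤ z.1)
    (hz1 : z.1 ≤ 3 * G.n - 1) : z ∈ G.boxB z := by
  obtain ⟨hn, hu₃, hu₁, hα, hαn, hy0, hy⟩ := hG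
  simp only [small, sqBox, Set.mem_setOf_eq, abs_le] at hzs
  simp only [boxB, mem_boxR_iff, bxRB, brB, brT]
  omega

/-- A lattice neighbour of `z` inside `B_{3n}` but outside box A is the left neighbour. [folklore] -/
theorem nbr_eq_of_not_boxA (hG : G.InRange) (hzb : z ∈ G.big) (hzs : z ∈ G.small) (hz : G.bxL' z ≤ z.1)
    {q : ℤ × ℤ} (hadj : planarAdj z q) (hqb : q ∈ G.big) (hqD : q ∉ G.boxA z) : q = (z.1 - 1, z.2) := by
  obtain ⟨hn, hu₃, hu₁, hα, hαn, hy0, hy⟩ := hG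
  simp only [big, small, sqBox, Set.mem_setOf_eq, abs_le, Prod.fst_zero, Prod.snd_zero, sub_zero] at hzb hzs hqb
  simp only [boxA, mem_boxR_iff, bxL', bxR, brB, brT, not_and] at hqD
  simp only [bxL'] at hz
  obtain ⟨z1, z2⟩ := z
  obtain ⟨q1, q2⟩ := q
  simp only [planarAdj, Prod.mk_add_mk, Prod.mk.injEq, add_zero] at hadj
  simp only [Prod.mk.injEq] at *
  omega

/-- A lattice neighbour of `z` inside `B_{3n}` but outside box B is the left neighbour when
`z₁ ≤ 3n - 2`, and the right neighbour when `z₁ = 3n - 1 > bxL' z`. [folklore] -/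
theorem nbr_unique_boxB (hG : G.InRange) (hzb : z ∈ G.big) (hzs : z ∈ G.small) (hz : G.bxL' z ≤ z.1)
    (hz1 : z.1 ≤ 3 * G.n - 1) :
    ∃ q₀ : ℤ × ℤ, ∀ q, planarAdj z q → q ∈ G.big → q ∉ G.boxB z → q = q₀ := by
  obtain ⟨hn, hu₃, hu₁, hα, hαn, hy0, hy⟩ := hG
  simp only [big, small, sqBox, Set.mem_setOf_eq, abs_le, Prod.fst_zero, Prod.snd_zero, sub_zero] at hzb hzs
  simp only [bxL'] at hz
  by_cases hcase : z.1 ≤ 3 * G.n - 2 ∨ G.bxL' z = z.1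
  · refine ⟨(z.1 - 1, z.2), fun q hadj hqb hqD => ?_⟩
    simp only [big, sqBox, Set.mem_setOf_eq, abs_le, Prod.fst_zero, Prod.snd_zero, sub_zero] at hqb
    simp only [boxB, mem_boxR_iff, bxL', bxRB, brB, brT, not_and] at hqD
    simp only [bxL'] at hcase
    obtain ⟨z1, z2⟩ := z
    obtain ⟨q1, q2⟩ := q
    simp only [planarAdj, Prod.mk_add_mk, Prod.mk.injEq, add_zero] at hadj
    simp only [Prod.mk.injEq] at *
    omega
  · refine ⟨(z.1 + 1, z.2), fun q hadj hqb hqD => ?_⟩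
    simp only [big, sqBox, Set.mem_setOf_eq, abs_le, Prod.fst_zero, Prod.snd_zero, sub_zero] at hqb
    simp only [boxB, mem_boxR_iff, bxL', bxRB, brB, brT, not_and] at hqD
    simp only [bxL'] at hcase
    obtain ⟨z1, z2⟩ := z
    obtain ⟨q1, q2⟩ := q
    simp only [planarAdj, Prod.mk_add_mk, Prod.mk.injEq, add_zero] at hadj
    simp only [Prod.mk.injEq] at *
    omega

/-- The unit box around `z`, within `B'_n` and to the right of `bxL' z - 1`, lies in box A.
[folklore] -/
theorem mem_boxA_of_sqBox_one (hG : G.InRange) {q : ℤ × ℤ} (hq : q ∈ sqBox z 1) (hqs : q ∈ G.small)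
    (hq1 : G.bxL' z ≤ q.1) : q ∈ G.boxA z := by
  obtain ⟨hn, hu₃, hu₁, hα, hαn, hy0, hy⟩ := hG
  simp only [small, sqBox, Set.mem_setOf_eq, abs_le, Nat.cast_one] at hq hqs
  simp only [boxA, mem_boxR_iff, bxR, brB, brT]
  omega

/-- The unit box around `z`, within `B'_n`, to the right of `bxL' z - 1` and left of `x = 3n`,
lies in box B. [folklore] -/
theorem mem_boxB_of_sqBox_one (hG : G.InRange) {q : ℤ × ℤ} (hq : q ∈ sqBox z 1) (hqs : q ∈ G.small)
    (hq1 : G.bxL' z ≤ q.1) (hq2 : q.1 ≤ 3 * G.n - 1) : q ∈ G.boxB z := by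
  obtain ⟨hn, hu₃, hu₁, hα, hαn, hy0, hy⟩ := hG
  simp only [small, sqBox, Set.mem_setOf_eq, abs_le, Nat.cast_one] at hq hqs
  simp only [boxB, mem_boxR_iff, bxRB, brB, brT]
  omega

/-- The last vertex of `γ_min(ω)` (for `ω ∈ A`) lies in the column `x = 3n`, hence off box B.
[folklore] -/
theorem getLast_not_boxB {ω : BondConfig (slab 3 k)} (hA : ω ∈ G.evA k) :
    ∀ v ∈ (G.γmin k ω).getLast?, planar k v ∉ G.boxB z := by
  intro v hv hvD
  obtain ⟨hγO, -⟩ := G.γmin_spec k hA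
  have hne := hγO.ne_nil
  have hv' : v = (G.γmin k ω).getLast hne := by
    rw [List.getLast?_eq_some_getLast hne] at hv
    simpa using hv.symm
  have hZ := hγO.last_mem hne
  rw [← hv', mem_slabLift_iff] at hZ
  simp only [zSeg, sideSeg, Set.mem_setOf_eq] at hZ
  simp only [boxB, mem_boxR_iff, bxRB] at hvD
  omega

/-- Off `lastBad`, the last vertex of `γ_min(ω)` is off box A (for `bxL' z ≤ z₁`). [folklore] -/
theorem getLast_not_boxA {ω : BondConfig (slab 3 k)} (hzl : z ∉ G.lastBad k ω) :
    ∀ v ∈ (G.γmin k ω).getLast?, planar k v ∉ G.boxA z := by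
  intro v hv hvD
  exact hzl ⟨v, hv, mem_sqBox_comm (boxA_subset_sqBox hvD)⟩

end BoxFacts

/-! ## Located surgery outputs from the two boxes -/

section Outputs

variable {ω : BondConfig (slab 3 k)} {z : ℤ × ℤ}

/-- PROVED — **located surgery at `z` with box A**: for `ω ∈ 𝒳` a lattice configuration,
`z ∈ U(ω)`-like data (`z ∈ B'_n` a column of `γ_min(ω)` with a (P2)-witness over `B'_n ∩ (z + B_1)`
to the right of `bxL' z - 1`), `bxL' z ≤ z₁`, `z ∉ zBad`, `z ∉ lastBad(ω)`: a located surgery output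
of radius `3` exists (whole range `u_{3n} ≤ n`). [cite: DuminilCopinSidoraviciusTassion2016, §2.3, proof of Fact 2 (construction of ω^{(z)})] -/
theorem exists_surgOut_boxA (hG : G.InRange) (hk : 0 < k) (hω : ω ⊆ (slabGraph 3 k).edgeSet)
    (hX : ω ∈ G.evX k) (hzs : z ∈ G.small) (hzγ : z ∈ G.γcols k ω) (hz : G.bxL' z ≤ z.1)
    (hzb : z ∉ G.zBad) (hzl : z ∉ G.lastBad k ω)
    {x₀ s' : slab 3 k} (hx₀ : planar k x₀ ∈ sqBox z 1) (hx₀1 : G.bxL' z ≤ (planar k x₀).1)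
    (hs' : s' ∈ slabLift k G.src')
    (hπ : ω ∈ openConnIn (slabLift k G.small ∩ {v | planar k v ∉ G.γcols k ω}) x₀ s') :
    ∃ ω', G.SurgOut k 3 ω z ω' := by
  have hA : ω ∈ G.evA k := hX.1.1.1
  obtain ⟨hγO, -⟩ := G.γmin_spec k hA
  have hzbig : z ∈ G.big := by
    obtain ⟨g, hgγ, hgz⟩ := hzγ
    rw [← hgz]; exact hγO.subset g hgγ
  have hx₀s : planar k x₀ ∈ G.small := by
    obtain ⟨hx, -, -⟩ := hπ
    exact hx.1
  obtain ⟨hf1, hf2, hf3, hf4⟩ := boxA_frame hG hzbig hzs hz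
  obtain ⟨sg, hsg⟩ := exists_surgery_rect (G := G) hk hω hX hf1 hf2 hf3 hf4
    (boxA_subset_region hG hzbig hzs) (fun q hq => boxA_not_src hq) (rpA_subset_big hG hzbig hzs)
    (fun q hq => rpA_not_zSeg hG hzbig hzb hq) (fun q hq hqb hqZ => mem_rpA_of hG hq hqb hqZ)
    (mem_boxA_self hG hzbig hzs hz) hzγ ⟨_, fun q h1 h2 h3 => nbr_eq_of_not_boxA hG hzbig hzs hz h1 h2 h3⟩
    (getLast_not_boxA hzl) (mem_boxA_of_sqBox_one hG hx₀ hx₀s hx₀1) hs' hπ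
  exact ⟨_, sg.surgOut hX (hsg ▸ boxA_subset_sqBox)⟩

/-- PROVED — **located surgery at `z` with box B** (no condition near `Z_n` or near the end of
`γ_min(ω)`): for `ω ∈ 𝒳` a lattice configuration, `z ∈ B'_n` a column of `γ_min(ω)` with
`bxL' z ≤ z₁ ≤ 3n - 1` and a (P2)-witness over `B'_n ∩ (z + B_1)` in the columns
`[bxL' z, 3n - 1]`: a located surgery output of radius `3` exists (whole range `u_{3n} ≤ n`).
[cite: DuminilCopinSidoraviciusTassion2016, §2.3, proof of Fact 2 (construction of ω^{(z)})] -/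
theorem exists_surgOut_boxB (hG : G.InRange) (hk : 0 < k) (hω : ω ⊆ (slabGraph 3 k).edgeSet)
    (hX : ω ∈ G.evX k) (hzs : z ∈ G.small) (hzγ : z ∈ G.γcols k ω) (hz : G.bxL' z ≤ z.1)
    (hz1 : z.1 ≤ 3 * G.n - 1)
    {x₀ s' : slab 3 k} (hx₀ : planar k x₀ ∈ sqBox z 1) (hx₀1 : G.bxL' z ≤ (planar k x₀).1)
    (hx₀2 : (planar k x₀).1 ≤ 3 * G.n - 1) (hs' : s' ∈ slabLift k G.src')
    (hπ : ω ∈ openConnIn (slabLift k G.small ∩ {v | planar k v ∉ G.γcols k ω}) x₀ s') :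
    ∃ ω', G.SurgOut k 3 ω z ω' := by
  have hA : ω ∈ G.evA k := hX.1.1.1
  obtain ⟨hγO, -⟩ := G.γmin_spec k hA
  have hzbig : z ∈ G.big := by
    obtain ⟨g, hgγ, hgz⟩ := hzγ
    rw [← hgz]; exact hγO.subset g hgγ
  have hx₀s : planar k x₀ ∈ G.small := by
    obtain ⟨hx, -, -⟩ := hπ
    exact hx.1
  obtain ⟨hf1, hf2, hf3, hf4⟩ := boxB_frame hG hzbig hzs hz hz1
  obtain ⟨sg, hsg⟩ := exists_surgery_rect (G := G) hk hω hX hf1 hf2 hf3 hf4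
    (boxB_subset_region hG hzbig hzs) (fun q hq => boxB_not_src hq) (rpB_subset_big hG hzbig hzs)
    (fun q hq => rpB_not_zSeg hq) (fun q hq hqb _ => mem_rpB_of hG hq hqb)
    (mem_boxB_self hG hzs hz hz1) hzγ (nbr_unique_boxB hG hzbig hzs hz hz1)
    (getLast_not_boxB hA) (mem_boxB_of_sqBox_one hG hx₀ hx₀s hx₀1 hx₀2) hs' hπ
  exact ⟨_, sg.surgOut hX (hsg ▸ boxB_subset_sqBox)⟩

end Outputs

end GlueGeom

end Boxes

end Literature.Probability.Percolation

end
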